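import Summits.NavierStokesRegularity.NavierStokesRegularity.Theses.AdiabaticEddy
import Summits.NavierStokesRegularity.NavierStokesRegularity.Theorems.AdiabaticEddyCorrectorSolvableVecUCP
import Summits.NavierStokesRegularity.NavierStokesRegularity.Theorems.AdiabaticEddyCorrectorSolvablePairUCP
import Summits.NavierStokesRegularity.NavierStokesRegularity.Theorems.AdiabaticEddyCorrectorSolvableVelocityBound
import Summits.NavierStokesRegularity.NavierStokesRegularity.Theorems.AdiabaticEddyCorrectorSolvablePressureBound
import Summits.NavierStokesRegularity.NavierStokesRegularity.Theorems.AdiabaticEddyCorrectorSolvableZeroBall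

/-!
# Refutation of `AdiabaticEddy.CorrectorSolvable` (stmt-NavierStokesRegularity-1429): the first-order frozen-eddy corrector equation has no compactly supported solution

Crux `Summit.NavierStokesRegularity.NavierStokesRegularity.Theses.AdiabaticEddy.CorrectorSolvable` of route
AdiabaticEddy asks for a nonzero smooth COMPACTLY SUPPORTED steady Euler flow `U`, smooth `W`, `q` on all of
`ℝ³`, constants `b < 0 < a + b`, `c`, solving the first-order corrector equation
(★) `(U·∇)W + (W·∇)U + ∇q = ΔU − aU + b(y·∇)U + (c·∇)U` pointwise on `ℝ³`.

It is FALSE, for every `U, W, q, a, b, c` (idea card `Cruxes/CorrectorSolvable/Ideas/stokes-carleman-kill.md`,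
memo `KillMemo-stokes-carleman.md`): read (★) as a Stokes-type system for `(U, q)` with `W` a smooth
coefficient. Then
* (velocity rows) `‖ΔU‖ ≤ C_R (‖U‖ + ‖DU‖ + ‖Dq‖)` on every ball (coefficients bounded on compacts);
* (pressure row = divergence of (★), using `div U = div W = 0`) `Δq = −tr(DW∘DU) − tr(DU∘DW)`, so
  `‖Δq‖ ≤ C_R ‖DU‖` on every ball;
* `U` vanishes on some ball `B(x₀, δ)` (compact support), and there `∇q = 0`, so `Q := q − q(x₀)`
  vanishes on that ball too;
* UNIQUE CONTINUATION for the coupled elliptic inequality `‖Δv‖ ≤ C(‖v‖ + ‖Dv‖)`, `v = (U, Q)`,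
  vanishing on an open ball ⇒ `v ≡ 0`. In the tree this is the time-independent case of the PROVED
  Escauriaza–Seregin–Šverák unique continuation theorem
  `Literature.Analysis.FluidPDE.ess_unique_continuation_holds` (ESS 2003 Thm. 4.1, for
  `|∂ₜu + Δu| ≤ c(|u| + |∇u|)` on `B(R) × ]0,T[` with a zero of infinite order at the origin), applied to
  `u(t, x) := v(x₀ + x)` (constant in `t`, identically zero near `x = 0`).
Hence `U = 0`, contradicting `U ≠ 0`.  No sign condition, no Euler equation for `U` and no decay of `W`
is used (the kill is sign-free; see the memo §4 for what it does NOT kill).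

The five steps are the registered stubs of the line, each landed as its own `--supports` file and imported here:
`correctorKill_vecUCP` (ESS application, `…Theorems.AdiabaticEddyCorrectorSolvableVecUCP`), `correctorKill_pairUCP`
(packaging a pair into `ℝᵐ`), `correctorKill_velocityBound`, `correctorKill_pressureBound`, `correctorKill_zeroBall`
(files `…Theorems.AdiabaticEddyCorrectorSolvable<Stub>`); this file is the composition `not_CorrectorSolvable`.
-/

noncomputable section

-- the summit-side namespace `Summit.NavierStokesRegularity.NavierStokesRegularity.…` repeats a component by design (D-0017)
set_option linter.dupNamespace false

namespace Summit.NavierStokesRegularity.NavierStokesRegularity.Theorems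

open Set Metric InnerProductSpace
open Literature.Analysis.FluidPDE
open Summit.NavierStokesRegularity.NavierStokesRegularity.Theses.AdiabaticEddy

/-- **`CorrectorSolvable` is false** (crux stmt-NavierStokesRegularity-1429 of route AdiabaticEddy,
REFUTED): no nonzero smooth compactly supported `U` admits globally smooth `W, q` and constants solving the
first-order corrector equation (★) — for ANY `a, b, c` and without using the Euler equation, `div W = 0`
only through the pressure row. Composition of Stubs A–E: normalise `Q := q − q(x₀)` on the zero ball of
Stub E, feed the bounds of Stubs C–D (common constant `max C₁ C₂`) into the coupled unique continuation of
Stubs A–B, get `U = 0`, contradiction. Classification for the planner: refuted-substantive for the typed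
first-order programme (compact support × full Laplacian at first order; sign-free), see the kill memo §4
for the surviving reformulations (edge layer of width `Re^{-1/2}`; interior corrector on non-localizable
flows). [cite: EscauriazaSereginSverak2003, Thm. 4.1] -/
theorem not_CorrectorSolvable : ¬ CorrectorSolvable := by
  rintro ⟨U, W, P, q, a, b, c, hU, -, hUc, hU0, hdivU, -, hW, hq, hdivW, -, -, hcorr⟩
  -- smoothness bookkeeping
  have hU3 : ContDiff ℝ 3 U := contDiff_infty.1 hU 3
  have hU2 : ContDiff ℝ 2 U := contDiff_infty.1 hU 2
  have hW2 : ContDiff ℝ 2 W := contDiff_infty.1 hW 2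
  have hW1 : ContDiff ℝ 1 W := contDiff_infty.1 hW 1
  have hq2 : ContDiff ℝ 2 q := contDiff_infty.1 hq 2
  have hq1 : ContDiff ℝ 1 q := contDiff_infty.1 hq 1
  -- Stub E: an open ball on which `U = 0` and `q` is constant
  obtain ⟨x₀, δ, hδ, hball⟩ := correctorKill_zeroBall U W q a b c hq1 hUc hcorr
  -- the normalised pressure
  set Q : EuclideanSpace ℝ (Fin 3) → ℝ := fun y => q y - q x₀ with hQdef
  have hQfun : Q = q - fun _ => q x₀ := rfl
  have hQ2 : ContDiff ℝ 2 Q := hq2.sub contDiff_const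
  have hfdQ : ∀ y, fderiv ℝ Q y = fderiv ℝ q y := fun y => by
    simp only [hQdef, fderiv_sub_const]
  have hΔQ : ∀ y, Laplacian.laplacian Q y = Laplacian.laplacian q y := fun y => by
    rw [hQfun, ContDiffAt.laplacian_sub hq2.contDiffAt contDiff_const.contDiffAt,
      InnerProductSpace.laplacian_const]
    simp
  -- Stubs A–D
  apply hU0
  refine correctorKill_pairUCP correctorKill_vecUCP U Q x₀ hU2 hQ2 ?_
    ⟨δ, hδ, fun y hy => ⟨(hball y hy).1, by simp [hQdef, (hball y hy).2]⟩⟩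
  intro R _hR
  obtain ⟨C₁, hC₁0, hC₁⟩ := correctorKill_velocityBound U W q a b c hW1 hcorr x₀ R
  obtain ⟨C₂, hC₂0, hC₂⟩ := correctorKill_pressureBound U W q a b c hU3 hW2 hq2 hdivU hdivW hcorr x₀ R
  refine ⟨max C₁ C₂, le_max_of_le_left hC₁0, fun y hy => ⟨?_, ?_⟩⟩
  · calc ‖Laplacian.laplacian U y‖ ≤ C₁ * (‖U y‖ + ‖fderiv ℝ U y‖ + ‖fderiv ℝ q y‖) := hC₁ y hy
      _ ≤ max C₁ C₂ * (‖U y‖ + ‖fderiv ℝ U y‖ + ‖Q y‖ + ‖fderiv ℝ Q y‖) := by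
        rw [hfdQ]
        have h1 : ‖U y‖ + ‖fderiv ℝ U y‖ + ‖fderiv ℝ q y‖ ≤
            ‖U y‖ + ‖fderiv ℝ U y‖ + ‖Q y‖ + ‖fderiv ℝ q y‖ := by
          linarith [norm_nonneg (Q y)]
        have h2 : 0 ≤ ‖U y‖ + ‖fderiv ℝ U y‖ + ‖Q y‖ + ‖fderiv ℝ q y‖ := by positivity
        calc C₁ * (‖U y‖ + ‖fderiv ℝ U y‖ + ‖fderiv ℝ q y‖)
            ≤ C₁ * (‖U y‖ + ‖fderiv ℝ U y‖ + ‖Q y‖ + ‖fderiv ℝ q y‖) :=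
              mul_le_mul_of_nonneg_left h1 hC₁0
          _ ≤ max C₁ C₂ * (‖U y‖ + ‖fderiv ℝ U y‖ + ‖Q y‖ + ‖fderiv ℝ q y‖) :=
              mul_le_mul_of_nonneg_right (le_max_left _ _) h2
  · calc ‖Laplacian.laplacian Q y‖ = ‖Laplacian.laplacian q y‖ := by rw [hΔQ]
      _ ≤ C₂ * (‖U y‖ + ‖fderiv ℝ U y‖) := hC₂ y hy
      _ ≤ max C₁ C₂ * (‖U y‖ + ‖fderiv ℝ U y‖ + ‖Q y‖ + ‖fderiv ℝ Q y‖) := by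
        have h1 : ‖U y‖ + ‖fderiv ℝ U y‖ ≤ ‖U y‖ + ‖fderiv ℝ U y‖ + ‖Q y‖ + ‖fderiv ℝ Q y‖ := by
          linarith [norm_nonneg (Q y), norm_nonneg (fderiv ℝ Q y)]
        have h2 : 0 ≤ ‖U y‖ + ‖fderiv ℝ U y‖ + ‖Q y‖ + ‖fderiv ℝ Q y‖ := by positivity
        calc C₂ * (‖U y‖ + ‖fderiv ℝ U y‖)
            ≤ C₂ * (‖U y‖ + ‖fderiv ℝ U y‖ + ‖Q y‖ + ‖fderiv ℝ Q y‖) :=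
              mul_le_mul_of_nonneg_left h1 hC₂0
          _ ≤ max C₁ C₂ * (‖U y‖ + ‖fderiv ℝ U y‖ + ‖Q y‖ + ‖fderiv ℝ Q y‖) :=
              mul_le_mul_of_nonneg_right (le_max_right _ _) h2

end Summit.NavierStokesRegularity.NavierStokesRegularity.Theorems

end
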